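import Mathlib
import Literature.Probability.Percolation.PercolationProofs
import Literature.Probability.LatticeModels.ProdBernoulliIndependence
import Literature.Probability.LatticeModels.ProdBernoulliClusterLocality
import Literature.Probability.LatticeModels.ProdBernoulliCoupling
import Literature.Probability.Percolation.ConditionalPositiveAssociation
import Literature.Probability.Percolation.KozmaNitzanPinning
import Summits.CriticalPhenomena.PercolationContinuityZ3.Theorems.PercNearOneGluingNearOneGluingKnLemma3i
import Summits.CriticalPhenomena.PercolationContinuityZ3.Theorems.PercNearOneGluingNearOneGluingWeightContinuity
import Summits.CriticalPhenomena.PercolationContinuityZ3.Theorems.PercNearOneGluingAdditiveGluingGluingLemma5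
import Summits.CriticalPhenomena.PercolationContinuityZ3.Theorems.PercNearOneGluingAdditiveGluingLemma5AnyRelay
import HarnessLib

/-!
# Crux `PercNearOneGluing.NoHeavyLowerTail` (stmt-CriticalPhenomena-4575), line `bhk-superadditivity-thinning` —
# Kozma–Nitzan Lemma 5 WITH SLACK (block form and `σ_B` form), lead c2

Helper file for the crux (lead prover-line-stmt-CriticalPhenomena-4575-c2-0, 2026-08-16); lands with
`--supports stmt-CriticalPhenomena-4575` (registered sub-goal `lemma5AnyRelaySlack`).

## Content

Kozma–Nitzan, arXiv:2401.12397, Lemma 5 (p. 13) is stated for a comparison point `a` that is AT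
MOST as reliable as the opened neighbour `v` off `o`.  Its proof (sprinkling + KN Lemma 3(i) +
`ε → 0`) runs verbatim with an additive slack: KN Lemma 3(i) (p. 6) carries a slack `δ′` through
the conditioning, so the hypothesis `P(a ↔ b) ≤ P(v ↔ b) + η` yields the conclusion with `+ η`
(times the probability of the conditioning event).  The two landed slack-free forms
(`stub_gluingLemma5`, block form, p75889; `stub_lemma5AnyRelay`, `σ_B` form, crux 4576) are
re-proved here with the slack `η ≥ 0`:

* `gluingLemma5_slack` : `μ_w(a ↔ b) ≤ μ_w(v ↔ b) + η`, `v ∈ S ∌ b` ⇒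
  `μ_{glue w S}(a ↔ b) ≤ μ_{glue w S}(S ↔ b) + η`;
* `lemma5AnyRelaySlack'` : `b ≠ o`, `a ≠ o`, `o ∉ B ∋ v`,
  `μ_w(a ↔ b in {o}ᶜ) ≤ μ_w(v ↔ b in {o}ᶜ) + η` ⇒
  `μ_w(σ_B ∩ {a ↔ b}) ≤ μ_w(σ_B ∩ {o ↔ b}) + η · μ_w(σ_B)`,
  `σ_B = {ω | ∀ y ≠ o, o–y open ↔ y ∈ B}`.

Why the slack matters (lead c2): with `η` fixed and `δ → 0`, EVERY relay point is `η`-admissible at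
a pocket one of whose entered points keeps reliability `≥ 1 − η` off the pocket, so the selection
cost of such pockets is the AVERAGE budget `(1/|A|) Σ_a μ(a ↮ b) + η` ("dependent-entrance
locality"); the slack-free admissibility compares reliabilities at resolution `δ` and is typically
satisfied by few points only.  Proofs: the landed ones, with `d(ε) + η` in place of `d(ε)`.
-/

namespace Summit.CriticalPhenomena.PercolationContinuityZ3.Theorems

open MeasureTheory Set
open Literature.Probability.LatticeModels (prodBernoulli)
open Literature.Probability.Percolation (BondConfig openConn openConnIn openGraph)

noncomputable section
open Classical

open Filter Topology Literature.Probability.LatticeModels Literature.Probability.Percolation in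
/-- **KN Lemma 5 for an arbitrary relay, block form, with slack `η`**: if
`P_w(a ↔ b) ≤ P_w(v ↔ b) + η` with `v ∈ S ∌ b` and `0 ≤ η`, then after gluing `S`,
`P_{glue w S}(a ↔ b) ≤ P_{glue w S}(S ↔ b) + η`.  Proof as for `stub_gluingLemma5` (sprinkle the
pairs inside `S`, condition on "all open" = glue, KN Lemma 3(i) with slack `d(ε) + η`, `ε → 0`).
[cite: KozmaNitzan2024, §3.2 Lemma 5 (p. 13) and Lemma 3(i) (p. 6)] -/
theorem gluingLemma5_slack (n : ℕ) (w : Sym2 (Fin n) → unitInterval) (S : Finset (Fin n))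
    (a v b : Fin n) (η : ℝ) (hvS : v ∈ S) (_hbS : b ∉ S) (hη : 0 ≤ η)
    (hle : (prodBernoulli w).real (openConn a b) ≤ (prodBernoulli w).real (openConn v b) + η) :
    (prodBernoulli (fun e : Sym2 (Fin n) =>
        if (∀ x ∈ e, x ∈ S) ∧ ¬ e.IsDiag then 1 else w e)).real (openConn a b) ≤
      (prodBernoulli (fun e : Sym2 (Fin n) =>
        if (∀ x ∈ e, x ∈ S) ∧ ¬ e.IsDiag then 1 else w e)).real (⋃ s ∈ S, openConn s b) + η := by
  set g : Sym2 (Fin n) → unitInterval :=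
    fun e => if (∀ x ∈ e, x ∈ S) ∧ ¬ e.IsDiag then 1 else w e with hg
  -- it suffices to compare with `v`: `{v ↔ b} ⊆ {S ↔ b}`
  refine le_trans ?_ (add_le_add
    (measureReal_mono (fun ω hω => Set.mem_iUnion₂.2 ⟨v, hvS, hω⟩) (measure_ne_top _ _))
    (le_refl η))
  -- `D` = non-loop pairs inside `S`, `E` = all of them open
  set D : Finset (Sym2 (Fin n)) :=
    Finset.univ.filter (fun e => (∀ x ∈ e, x ∈ S) ∧ ¬ e.IsDiag) with hDdef
  have hD : ∀ e, e ∈ D ↔ (∀ x ∈ e, x ∈ S) ∧ ¬ e.IsDiag := fun e => by simp [hDdef]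
  set E : Set (BondConfig (Fin n)) := {ω | (↑D : Set (Sym2 (Fin n))) ⊆ ω} with hEdef
  -- the sprinkled weights `w_ε`
  set u : unitInterval → Sym2 (Fin n) → unitInterval :=
    fun ε e => if e ∈ D then Set.Icc.convexComb (w e) 1 ε else w e with hu
  have hwu : ∀ ε, w ≤ u ε := by
    intro ε e
    by_cases he : e ∈ D
    · simp only [hu, he, if_true]
      exact Set.Icc.le_convexComb unitInterval.le_one' ε
    · simp only [hu, he, if_false]
      exact le_rfl
  have hu0 : u 0 = w := by
    funext e
    by_cases he : e ∈ D
    · simp only [hu, he, if_true, Set.Icc.convexComb_zero]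
    · simp only [hu, he, if_false]
  have hucont : Continuous u := by
    refine continuous_pi fun e => ?_
    by_cases he : e ∈ D
    · simp only [hu, he, if_true]
      exact Set.Icc.continuous_convexComb (w e) 1
    · simp only [hu, he, if_false]
      exact continuous_const
  -- gluing `u ε` along `D` gives `g`, whatever `ε`
  have hpin : ∀ ε, (fun e => if e ∈ D then (1 : unitInterval) else u ε e) = g := by
    intro ε
    funext e
    by_cases he : e ∈ D
    · simp only [hg, he, if_true, if_pos ((hD e).1 he)]
    · have he' : ¬ ((∀ x ∈ e, x ∈ S) ∧ ¬ e.IsDiag) := fun h => he ((hD e).2 h)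
      simp only [hg, hu, he, if_false, if_neg he']
  -- conditioning on `E` is gluing
  have hcond : ∀ ε (X : Set (BondConfig (Fin n))),
      (prodBernoulli (u ε)).real (X ∩ E) =
        (prodBernoulli (u ε)).real E * (prodBernoulli g).real X := by
    intro ε X
    rw [hEdef, gluingLemma5_real_inter_allOpen (u ε) D MeasurableSet.of_discrete, hpin ε]
  -- `E` has positive probability under `u ε`, `ε > 0`
  have hpos : ∀ ε : unitInterval, 0 < (ε : ℝ) → 0 < (prodBernoulli (u ε)).real E := by
    intro ε hε
    rw [hEdef, prodBernoulli_real_subset (u ε) D]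
    refine Finset.prod_pos fun e he => ?_
    simp only [hu, he, if_true, Set.Icc.coe_convexComb, Set.Icc.coe_one, mul_one]
    exact add_pos_of_nonneg_of_pos
      (mul_nonneg (unitInterval.one_minus_nonneg ε) (unitInterval.nonneg (w e))) hε
  -- the step at fixed `ε > 0`
  have hstep : ∀ ε : unitInterval, 0 < (ε : ℝ) →
      (prodBernoulli g).real (openConn a b) ≤ (prodBernoulli g).real (openConn v b) +
        (((prodBernoulli (u ε)).real (openConn a b) - (prodBernoulli w).real (openConn a b)) + η) := by
    intro ε hε
    have hma : (prodBernoulli w).real (openConn a b) ≤ (prodBernoulli (u ε)).real (openConn a b) :=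
      prodBernoulli_real_mono_of_isUpperSet (hwu ε) (isUpperSet_openConn a b)
        MeasurableSet.of_discrete
    have hmv : (prodBernoulli w).real (openConn v b) ≤ (prodBernoulli (u ε)).real (openConn v b) :=
      prodBernoulli_real_mono_of_isUpperSet (hwu ε) (isUpperSet_openConn v b)
        MeasurableSet.of_discrete
    have h3 := knLemma3i n (u ε) a v b E
      (((prodBernoulli (u ε)).real (openConn a b) - (prodBernoulli w).real (openConn a b)) + η)
      (gluingLemma5_allOpen_mono hD hvS) (add_nonneg (sub_nonneg.2 hma) hη) (by linarith)
    rw [hcond ε (openConn a b), hcond ε (openConn v b)] at h3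
    refine le_of_mul_le_mul_left (h3.trans_eq ?_) (hpos ε hε)
    ring
  -- `ε → 0`
  obtain ⟨ε, hεpos, hεlim⟩ := gluingLemma5_exists_seq_tendsto_zero
  have hF : Continuous fun t : unitInterval => (prodBernoulli (u t)).real (openConn a b) :=
    (stub_weightContinuity n (openConn a b)).comp hucont
  have hlim : Tendsto (fun k => (prodBernoulli g).real (openConn v b) +
      (((prodBernoulli (u (ε k))).real (openConn a b) - (prodBernoulli w).real (openConn a b)) + η))
      atTop (𝓝 ((prodBernoulli g).real (openConn v b) +
        (((prodBernoulli (u 0)).real (openConn a b) - (prodBernoulli w).real (openConn a b)) + η))) :=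
    tendsto_const_nhds.add ((((hF.tendsto 0).comp hεlim).sub tendsto_const_nhds).add
      tendsto_const_nhds)
  rw [hu0, sub_self, zero_add] at hlim
  exact ge_of_tendsto' hlim fun k => hstep (ε k) (hεpos k)

open Filter Literature.Probability.LatticeModels Literature.Probability.Percolation in
/-- **KN Lemma 5 for an arbitrary relay, `σ_B` form, with slack `η`**: for `b ≠ o`, `a ≠ o`,
`o ∉ B ∋ v`, `0 ≤ η` and `μ_w(a ↔ b in {o}ᶜ) ≤ μ_w(v ↔ b in {o}ᶜ) + η`,
`μ_w(σ_B ∩ {a ↔ b}) ≤ μ_w(σ_B ∩ {o ↔ b}) + η · μ_w(σ_B)` with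
`σ_B = {ω | ∀ y ≠ o, o–y open ↔ y ∈ B}`.  Proof as for `stub_lemma5AnyRelay`: conditioning on
`σ_B` is pinning; killing the star is deleting `o`; glue the block `insert o B` with
`gluingLemma5_slack`; wire; the slack survives as `+ η` in the pinned world, i.e. `+ η μ(σ_B)`.
[cite: KozmaNitzan2024, §3.2 Lemma 5 (p. 13) and Lemma 3(i) (p. 6)] -/
theorem lemma5AnyRelaySlack' (n : ℕ) (w : Sym2 (Fin n) → unitInterval) (o b a v : Fin n)
    (B : Finset (Fin n)) (η : ℝ) (hbo : b ≠ o) (hao : a ≠ o) (hoB : o ∉ B) (hvB : v ∈ B)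
    (hη : 0 ≤ η)
    (hle : (prodBernoulli w).real (openConnIn (({o} : Set (Fin n))ᶜ) a b)
        ≤ (prodBernoulli w).real (openConnIn (({o} : Set (Fin n))ᶜ) v b) + η) :
    (prodBernoulli w).real
        ({ω : BondConfig (Fin n) | ∀ y : Fin n, y ≠ o → (s(o, y) ∈ ω ↔ y ∈ B)} ∩ openConn a b)
      ≤ (prodBernoulli w).real
          ({ω : BondConfig (Fin n) | ∀ y : Fin n, y ≠ o → (s(o, y) ∈ ω ↔ y ∈ B)} ∩ openConn o b) +
        η * (prodBernoulli w).real
          {ω : BondConfig (Fin n) | ∀ y : Fin n, y ≠ o → (s(o, y) ∈ ω ↔ y ∈ B)} := by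
  have hησ : 0 ≤ η * (prodBernoulli w).real
      {ω : BondConfig (Fin n) | ∀ y : Fin n, y ≠ o → (s(o, y) ∈ ω ↔ y ∈ B)} :=
    mul_nonneg hη measureReal_nonneg
  -- Case `b ∈ B`: under `σ_B` the pair `o–b` is open, so `σ_B ⊆ {o ↔ b}`.
  by_cases hbB : b ∈ B
  · have hsub : {ω : BondConfig (Fin n) | ∀ y : Fin n, y ≠ o → (s(o, y) ∈ ω ↔ y ∈ B)} ⊆
        openConn o b := fun ω hω =>
      ((openGraph_adj ω o b).2 ⟨(hω b hbo).2 hbB, hbo.symm⟩).reachable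
    rw [Set.inter_eq_left.2 hsub]
    exact le_add_of_le_of_nonneg (measureReal_mono Set.inter_subset_left (measure_ne_top _ _)) hησ
  -- Henceforth `b ∉ B`.
  have hvo : v ≠ o := fun h => hoB (h ▸ hvB)
  -- the star `F` of `o` and the pattern `ξ = {o–y | y ∈ B}` on it
  obtain ⟨F, hmemF⟩ : ∃ F : Finset (Sym2 (Fin n)),
      ∀ e, e ∈ (↑F : Set (Sym2 (Fin n))) ↔ o ∈ e ∧ ¬ e.IsDiag :=
    ⟨Finset.univ.filter fun e => o ∈ e ∧ ¬ e.IsDiag, fun e => by simp⟩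
  obtain ⟨ξ, hmemξ⟩ : ∃ ξ : Set (Sym2 (Fin n)), ∀ y : Fin n, s(o, y) ∈ ξ ↔ y ∈ B := by
    refine ⟨(fun y => s(o, y)) '' ↑B, fun y => ?_⟩
    rw [Function.Injective.mem_set_image fun y y' h => Sym2.congr_right.1 h, Finset.mem_coe]
  have hstar : ∀ y : Fin n, y ≠ o → s(o, y) ∈ (↑F : Set (Sym2 (Fin n))) := fun y hy =>
    (hmemF _).2 ⟨Sym2.mem_mk_left o y, fun h => hy (Sym2.mk_isDiag_iff.1 h).symm⟩
  -- `σ_B` is the cylinder `[ξ]_F`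
  have hσ : {ω : BondConfig (Fin n) | ∀ y : Fin n, y ≠ o → (s(o, y) ∈ ω ↔ y ∈ B)} =
      localCylinder (↑F : Set (Sym2 (Fin n))) ξ := by
    ext ω
    constructor
    · intro hω e he
      obtain ⟨hoe, hde⟩ := (hmemF e).1 he
      obtain ⟨y, rfl⟩ := Sym2.mem_iff_exists.1 hoe
      rw [hmemξ]
      exact hω y fun h => hde (Sym2.mk_isDiag_iff.2 h.symm)
    · intro hω y hyo
      rw [← hmemξ y]
      exact hω _ (hstar y hyo)
  -- conditioning on `σ_B` is pinning
  have hcond : ∀ X : Set (BondConfig (Fin n)),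
      (prodBernoulli w).real (localCylinder (↑F : Set (Sym2 (Fin n))) ξ ∩ X) =
        (prodBernoulli w).real (localCylinder (↑F : Set (Sym2 (Fin n))) ξ) *
          (prodBernoulli (pinW w ↑F ξ)).real X := fun X => by
    rw [Set.inter_comm]
    exact prodBernoulli_real_inter_localCylinder w F ξ MeasurableSet.of_discrete
  rw [hσ, hcond, hcond, mul_comm η, ← mul_add]
  refine mul_le_mul_of_nonneg_left ?_ measureReal_nonneg
  -- kill the star of `o`: the weighting `w0`, and the hypothesis in `w0`-form
  obtain ⟨w0, hw0⟩ : ∃ w0 : Sym2 (Fin n) → unitInterval,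
      ∀ e, w0 e = if o ∈ e ∧ ¬ e.IsDiag then 0 else w e := ⟨_, fun _ => rfl⟩
  have hW1 : ∀ e ∈ (({o} : Set (Fin n))ᶜ).sym2, w e = w0 e := by
    intro e he
    induction e with
    | h x y =>
      rw [Set.mk_mem_sym2_iff, Set.mem_compl_singleton_iff, Set.mem_compl_singleton_iff] at he
      have hne : ¬ (o ∈ s(x, y) ∧ ¬ (s(x, y)).IsDiag) := fun h => by
        rcases Sym2.mem_iff.1 h.1 with h' | h'
        · exact he.1 h'.symm
        · exact he.2 h'.symm
      rw [hw0, if_neg hne]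
  have hW2 : ∀ y : Fin n, y ≠ o → w0 s(o, y) = 0 := fun y hy => by
    rw [hw0, if_pos ((hmemF _).1 (hstar y hy))]
  have hle0 : (prodBernoulli w0).real (openConn a b) ≤
      (prodBernoulli w0).real (openConn v b) + η := by
    rw [← lemma5AnyRelay_real_openConnIn_compl_eq w w0 o a b hao hW1 hW2,
      ← lemma5AnyRelay_real_openConnIn_compl_eq w w0 o v b hvo hW1 hW2]
    exact hle
  -- glue the block `S = insert o B`
  have hvS : v ∈ insert o B := Finset.mem_insert_of_mem hvB
  have hbS : b ∉ insert o B := by simp [hbo, hbB]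
  have hglue := gluingLemma5_slack n w0 (insert o B) a v b η hvS hbS hη hle0
  -- the glued weighting is the wiring of the pinned one
  have hW3 : ∀ e : Sym2 (Fin n),
      (if (∀ x ∈ e, x ∈ insert o B) ∧ ¬ e.IsDiag then (1 : unitInterval) else w0 e) =
        wireW (↑(insert o B) : Set (Fin n)) (pinW w ↑F ξ) e := by
    intro e
    have hwire : e ∈ wireSet (↑(insert o B) : Set (Fin n)) ↔
        (∀ x ∈ e, x ∈ insert o B) ∧ ¬ e.IsDiag := by
      simp only [wireSet, Set.mem_setOf_eq, Finset.mem_coe]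
    by_cases he : (∀ x ∈ e, x ∈ insert o B) ∧ ¬ e.IsDiag
    · rw [if_pos he, wireW_apply_of_mem _ (hwire.2 he)]
    · rw [if_neg he, wireW_apply_of_not_mem _ fun h => he (hwire.1 h), hw0 e]
      by_cases hoe : o ∈ e ∧ ¬ e.IsDiag
      · rw [if_pos hoe]
        obtain ⟨y, rfl⟩ := Sym2.mem_iff_exists.1 hoe.1
        have hyB : y ∉ B := by
          intro hyB
          refine he ⟨fun x hx => ?_, hoe.2⟩
          rcases Sym2.mem_iff.1 hx with rfl | rfl
          · exact Finset.mem_insert_self _ _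
          · exact Finset.mem_insert_of_mem hyB
        exact (pinW_apply_of_mem_of_not_mem w ((hmemF _).2 hoe)
          fun h => hyB ((hmemξ y).1 h)).symm
      · rw [if_neg hoe]
        exact (pinW_apply_of_not_mem w ξ fun h => hoe ((hmemF e).1 h)).symm
  rw [show (fun e : Sym2 (Fin n) =>
      if (∀ x ∈ e, x ∈ insert o B) ∧ ¬ e.IsDiag then (1 : unitInterval) else w0 e) =
      wireW (↑(insert o B) : Set (Fin n)) (pinW w ↑F ξ) from funext hW3] at hglue
  -- every pair `o–y`, `y ∈ B`, is pinned open
  have hW4 : ∀ y ∈ B, pinW w (↑F : Set (Sym2 (Fin n))) ξ s(o, y) = 1 := fun y hy =>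
    pinW_apply_of_mem_of_mem w (hstar y fun h => hoB (h ▸ hy)) ((hmemξ y).2 hy)
  calc (prodBernoulli (pinW w (↑F : Set (Sym2 (Fin n))) ξ)).real (openConn a b)
      ≤ (prodBernoulli (wireW (↑(insert o B) : Set (Fin n)) (pinW w ↑F ξ))).real
          (openConn a b) :=
        prodBernoulli_real_mono_of_isUpperSet (le_wireW _ _) (isUpperSet_openConn a b)
          MeasurableSet.of_discrete
    _ ≤ (prodBernoulli (wireW (↑(insert o B) : Set (Fin n)) (pinW w ↑F ξ))).real
          (⋃ s ∈ insert o B, openConn s b) + η := hglue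
    _ = (prodBernoulli (pinW w (↑F : Set (Sym2 (Fin n))) ξ)).real (openConn o b) + η := by
        rw [lemma5AnyRelay_wire_real_biUnion _ o b B hoB hW4]

end

/-- **Registered sub-goal `lemma5AnyRelaySlack` of crux stmt-CriticalPhenomena-4575** (verbatim signature,
fully qualified) — see `lemma5AnyRelaySlack'`. -/
theorem lemma5AnyRelaySlack :
    ∀ (n : ℕ) (w : Sym2 (Fin n) → unitInterval) (o b a v : Fin n) (B : Finset (Fin n)) (η : ℝ), b ≠ o → a ≠ o → o ∉ B → v ∈ B → 0 ≤ η → (Literature.Probability.LatticeModels.prodBernoulli w).real (Literature.Probability.Percolation.openConnIn ((({o} : Set (Fin n))ᶜ)) a b) ≤ (Literature.Probability.LatticeModels.prodBernoulli w).real (Literature.Probability.Percolation.openConnIn ((({o} : Set (Fin n))ᶜ)) v b) + η → (Literature.Probability.LatticeModels.prodBernoulli w).real ({ω : Literature.Probability.Percolation.BondConfig (Fin n) | ∀ y : Fin n, y ≠ o → (s(o, y) ∈ ω ↔ y ∈ B)} ∩ Literature.Probability.Percolation.openConn a b) ≤ (Literature.Probability.LatticeModels.prodBernoulli w).real ({ω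 : Literature.Probability.Percolation.BondConfig (Fin n) | ∀ y : Fin n, y ≠ o → (s(o, y) ∈ ω ↔ y ∈ B)} ∩ Literature.Probability.Percolation.openConn o b) + η * (Literature.Probability.LatticeModels.prodBernoulli w).real {ω : Literature.Probability.Percolation.BondConfig (Fin n) | ∀ y : Fin n, y ≠ o → (s(o, y) ∈ ω ↔ y ∈ B)} :=
  fun n w o b a v B η hbo hao hoB hvB hη hle => lemma5AnyRelaySlack' n w o b a v B η hbo hao hoB hvB hη hle

end Summit.CriticalPhenomena.PercolationContinuityZ3.Theorems
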